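import Literature.NumberTheory.GaloisRepresentations.HeckeCharacterProofs
import Literature.NumberTheory.GaloisRepresentations.HeckeCharacterRamificationProofs
import HarnessLib

/-!
# Weak approximation and the rigidity of Hecke characters (proof file)

Topic `NumberTheory/GaloisRepresentations`; namespace `Literature` / `Literature.NumberTheory.GaloisRepresentations.HeckeCharacter`. Sibling proof
file of `HeckeCharacter` (Hecke characters `χ : 𝕀_K →ₜ* ℂˣ`, `localUnits v : K_vˣ → 𝕀_K`,
`IsUnramifiedAt`, `valueAtUniformizer`), `HeckeCharacterProofs` (neighbourhoods of `1` in `𝕀_K`)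
and `HeckeCharacterRamificationProofs` (`finite_ramifiedPlaces_holds`). Everything here is
**proved** (no named facts):

* `Literature.NumberTheory.GaloisRepresentations.denseRange_algebraMap_pi_prod` — **weak approximation at finitely many finite places and
  all infinite places**: for a finite set `S` of finite places of the number field `K`, the
  diagonal map `K → (∏_{v ∈ S} K_v) × ∏_{w ∣ ∞} K_w` has dense range. This is Cassels–Fröhlich,
  Ch. II (Cassels), §6, Lemma ("weak approximation theorem": `k` is dense in `∏ k_n` for finitely
  many inequivalent non-trivial valuations), obtained from Mathlib's abstract Artin–Whaples theorem
  `AbsoluteValue.denseRange_algebraMap_pi` applied to the `v`-adic absolute values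
  (`NumberField.HeightOneSpectrum.adicAbv`) for `v ∈ S` together with the archimedean ones, after
  checking that these are non-trivial and pairwise inequivalent
  (`adicAbv_isNontrivial`, `not_isEquiv_adicAbv`, `not_isEquiv_adicAbv_infinitePlace`), and then
  passing to the completions (`K → K_v` is an isometry with dense image).
* `Literature.NumberTheory.GaloisRepresentations.HeckeCharacter.eq_one_of_forall_localUnits` — **`K^× 𝕀_K^S` is dense in `𝕀_K`, in the form
  used for characters**: a Hecke character `χ` with `χ ∘ localUnits v = 1` for all `v ∉ S`
  (`S` finite) is trivial. This is the uniqueness half of Cassels–Fröhlich, Ch. VII (Tate), §4,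
  Prop. 4.1 and its printed proof ("`ψ(x) = ψ(ax) = ψ((ax)_1) ψ((ax)_2)` … by the (weak)
  approximation theorem we can find `a_n ∈ K^*` with `a_n → x^{-1}` at all `v ∈ S`";
  equivalently "`K^* J_K^S` is a dense subset of `J_K`", loc. cit. §4.4 and §8.6): we split
  `x = a · (x a⁻¹)_1 · (x a⁻¹)_2` with `a ∈ K^×` close to `x` at `S ∪ ∞`
  (`denseRange_algebraMap_pi_prod`), where `(·)_1` keeps the components at `S ∪ ∞`; `χ` kills `a`
  and `(x a⁻¹)_2` (`eq_one_of_fst_eq_one`, itself a closure argument over finite sub-products of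
  `∏_{v ∉ S} K_vˣ`), and `(x a⁻¹)_1 → 1`.
* `Literature.NumberTheory.GaloisRepresentations.HeckeCharacter.eq_one_of_eventually_valueAtUniformizer_eq_one`,
  `Literature.NumberTheory.GaloisRepresentations.HeckeCharacter.ext_of_eventually_valueAtUniformizer_eq` — consequences (with
  `map_localUnits_of_valueAtUniformizer_eq_one` of `HeckeCharacterProofs`: `χ_v = 1` on
  `K_vˣ = ϖ_v^ℤ 𝒪_vˣ` once `χ` is unramified at `v` with `χ(ϖ_v) = 1`): a Hecke character with
  `χ(ϖ_v) = 1` for almost all `v` is trivial; **two Hecke characters with the same values at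
  almost all uniformizers are equal** ("multiplicity one for `GL(1)`").
* `Literature.NumberTheory.GaloisRepresentations.ideleGroup_exists_nhds_congruenceSubgroup_subset` — the neighbourhood basis of `1` in `𝕀_K`
  used on the way (as `ideleGroup_exists_congruenceSubgroup_subset` of `HeckeCharacterProofs`, but
  allowing an archimedean component in a neighbourhood of `1` instead of equal to `1`).

(The componentwise facts `x_w ≠ 0`, `(x⁻¹)_w = x_w⁻¹` for ideles are kept local to the proofs; they
exist as `idele_fst_apply_ne_zero`, `idele_inv_fst_apply` in `Automorphic/NormOneIdeleClassCompact`,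
which is not imported here.)

## References

* J. W. S. Cassels, A. Fröhlich (eds.), *Algebraic Number Theory* (1967): Ch. II (Cassels,
  *Global fields*), §6, Lemma (weak approximation theorem); Ch. VII (Tate, *Global class field
  theory*), §4, Prop. 4.1 and its proof. [CasselsFrohlichANT1967]
* E. Artin, G. Whaples, *Axiomatic characterization of fields by the product formula for
  valuations*, Bull. AMS 51 (1945), Thm. 1 (the approximation theorem) — Mathlib
  `AbsoluteValue.denseRange_algebraMap_pi`.

## Mathlib

`AbsoluteValue.denseRange_algebraMap_pi`, `AbsoluteValue.isEquiv_iff_lt_one_iff`,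
`NumberField.InfinitePlace.eq_iff_isEquiv`, `NumberField.HeightOneSpectrum.adicAbv`,
`NumberField.FinitePlace.norm_embedding`, `IsDedekindDomain.HeightOneSpectrum.denseRange_algebraMap`,
`NumberField.InfinitePlace.Completion.denseRange_coe`, `Equiv.sumPiEquivProdPi`,
`DenseRange.piMap`, `DenseRange.prodMap` are used as is.
-/

noncomputable section

open NumberField IsDedekindDomain Filter Topology

namespace Literature.NumberTheory.GaloisRepresentations

universe u

variable {K : Type u} [Field K] [NumberField K]

/-! ### Weak approximation: finitely many finite places and all infinite places -/

section WeakApproximation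

/-- The `v`-adic absolute value of a number field is non-trivial (a non-zero element of `𝔭_v` has
absolute value `< 1`). [folklore] -/
theorem adicAbv_isNontrivial (v : HeightOneSpectrum (𝓞 K)) :
    (NumberField.HeightOneSpectrum.adicAbv K v).IsNontrivial := by
  obtain ⟨x, hxv, hx0⟩ := Submodule.exists_mem_ne_zero_of_ne_bot v.ne_bot
  refine ⟨algebraMap (𝓞 K) K x, fun h => hx0 ?_, ?_⟩
  · exact FaithfulSMul.algebraMap_injective (𝓞 K) K (by rw [h, map_zero])
  · rw [← FinitePlace.norm_embedding]
    exact ((FinitePlace.norm_lt_one_iff_mem K v x).2 hxv).ne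

/-- Distinct finite places of a number field define inequivalent absolute values (an element of
`𝔭_v ∖ 𝔭_w` has `|·|_v < 1 = |·|_w`). Cassels–Fröhlich, Ch. II §4 (independence).
[cite: CasselsFrohlichANT1967, Ch. II §6 Lemma (weak approximation theorem)] -/
theorem not_isEquiv_adicAbv {v w : HeightOneSpectrum (𝓞 K)} (h : v ≠ w) :
    ¬ (NumberField.HeightOneSpectrum.adicAbv K v).IsEquiv
      (NumberField.HeightOneSpectrum.adicAbv K w) := by
  intro he
  have hle : ¬ v.asIdeal ≤ w.asIdeal := fun hle =>
    h (HeightOneSpectrum.ext (v.isMaximal.eq_of_le w.isPrime.ne_top hle))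
  obtain ⟨x, hxv, hxw⟩ := SetLike.not_le_iff_exists.1 hle
  have h1 : NumberField.HeightOneSpectrum.adicAbv K v (algebraMap (𝓞 K) K x) < 1 := by
    rw [← FinitePlace.norm_embedding]
    exact (FinitePlace.norm_lt_one_iff_mem K v x).2 hxv
  have h2 : NumberField.HeightOneSpectrum.adicAbv K w (algebraMap (𝓞 K) K x) = 1 := by
    rw [← FinitePlace.norm_embedding]
    exact (FinitePlace.norm_eq_one_iff_notMem K w x).2 hxw
  have := he.lt_one_iff.1 h1
  rw [h2] at this
  exact lt_irrefl _ this

/-- A finite place and an infinite place of a number field define inequivalent absolute values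
(`|2|_v ≤ 1 < |2|_w`). [cite: CasselsFrohlichANT1967, Ch. II §6 Lemma (weak approximation theorem)] -/
theorem not_isEquiv_adicAbv_infinitePlace (v : HeightOneSpectrum (𝓞 K)) (w : InfinitePlace K) :
    ¬ (NumberField.HeightOneSpectrum.adicAbv K v).IsEquiv w.1 := by
  intro he
  have h1 : ¬ 1 < NumberField.HeightOneSpectrum.adicAbv K v (2 : K) :=
    not_lt.2 (by simpa using NumberField.HeightOneSpectrum.adicAbv_natCast_le_one K v 2)
  have h2 : 1 < w.1 (2 : K) := by
    have : w.1 (2 : K) = 2 := by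
      rw [← InfinitePlace.coe_apply]
      exact_mod_cast InfinitePlace.map_natCast w 2
    rw [this]
    norm_num
  exact h1 (he.one_lt_iff.2 h2)

/-- **Weak approximation (finitely many finite places together with all infinite places).** For a
finite set `S` of finite places of the number field `K`, the diagonal map
`K → (∏_{v ∈ S} K_v) × ∏_{w ∣ ∞} K_w` has dense range. Cassels–Fröhlich, Ch. II (Cassels), §6,
Lemma: for finitely many inequivalent non-trivial valuations `|·|_n` of a field `k`, the image of
`k` is dense in `∏_n k_n`; here from Mathlib's Artin–Whaples theorem
`AbsoluteValue.denseRange_algebraMap_pi` for the family `(|·|_v)_{v ∈ S} ⊔ (|·|_w)_{w ∣ ∞}`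
(non-trivial and pairwise inequivalent by `adicAbv_isNontrivial`, `InfinitePlace.isNontrivial`,
`not_isEquiv_adicAbv`, `not_isEquiv_adicAbv_infinitePlace`, `InfinitePlace.eq_iff_isEquiv`),
followed by the isometric dense embeddings `K → K_v`, `K → K_w` into the completions.
[cite: CasselsFrohlichANT1967, Ch. II §6 Lemma (weak approximation theorem)] -/
theorem denseRange_algebraMap_pi_prod (S : Finset (HeightOneSpectrum (𝓞 K))) :
    DenseRange fun k : K =>
      ((fun v : S => algebraMap K (v.1.adicCompletion K) k), algebraMap K (InfiniteAdeleRing K) k) := by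
  classical
  -- the finite family of absolute values
  let abv : (S : Type u) ⊕ InfinitePlace K → AbsoluteValue K ℝ :=
    Sum.elim (fun v => NumberField.HeightOneSpectrum.adicAbv K v.1) fun w => w.1
  have hnt : ∀ i, (abv i).IsNontrivial := by
    rintro (v | w)
    · exact adicAbv_isNontrivial v.1
    · exact w.isNontrivial
  have hpw : Pairwise fun i j => ¬ (abv i).IsEquiv (abv j) := by
    rintro (v | w) (v' | w') hij
    · exact not_isEquiv_adicAbv fun h => hij (by rw [Subtype.ext h])
    · exact not_isEquiv_adicAbv_infinitePlace v.1 w'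
    · exact fun h => not_isEquiv_adicAbv_infinitePlace v'.1 w h.symm
    · exact fun h => hij (congrArg Sum.inr (InfinitePlace.eq_iff_isEquiv.2 h))
  have hd := AbsoluteValue.denseRange_algebraMap_pi hnt hpw
  -- coordinate maps into the completions
  let F : ∀ v : (S : Type u), WithAbs (NumberField.HeightOneSpectrum.adicAbv K v.1) →
      v.1.adicCompletion K :=
    fun v a => algebraMap K (v.1.adicCompletion K) (WithAbs.equiv _ a)
  let G : ∀ w : InfinitePlace K, WithAbs w.1 → w.Completion := fun w a => (a : w.Completion)
  have hFc : ∀ v, Continuous (F v) := by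
    intro v
    have hn : ∀ a, ‖((algebraMap K (v.1.adicCompletion K)).comp
        (WithAbs.equiv (NumberField.HeightOneSpectrum.adicAbv K v.1)).toRingHom) a‖ = ‖a‖ := by
      intro a
      change ‖algebraMap K (v.1.adicCompletion K) (WithAbs.equiv _ a)‖ = _
      rw [WithAbs.norm_eq_apply_ofAbs, algebraMap_adicCompletion_apply]
      exact FinitePlace.norm_embedding v.1 _
    exact (AddMonoidHomClass.isometry_of_norm _ hn).continuous
  have hFd : ∀ v, DenseRange (F v) := by
    intro v
    change Dense (Set.range ((algebraMap K (v.1.adicCompletion K)) ∘ (WithAbs.equiv _)))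
    rw [(WithAbs.equiv _).surjective.range_comp]
    exact HeightOneSpectrum.denseRange_algebraMap K v.1
  have hGc : ∀ w, Continuous (G w) := fun w => InfinitePlace.Completion.continuous_coe w
  have hGd : ∀ w, DenseRange (G w) := fun w => InfinitePlace.Completion.denseRange_coe w
  -- the rearrangement `∏_{S ⊔ ∞} → (∏_S) × (∏_∞)` followed by the coordinate maps
  have h1 : DenseRange (Prod.map (Pi.map F) (Pi.map G)) :=
    (DenseRange.piMap fun v => hFd v).prodMap (DenseRange.piMap fun w => hGd w)
  have h2 : Continuous (Prod.map (Pi.map F) (Pi.map G)) :=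
    (Continuous.piMap fun v => hFc v).prodMap (Continuous.piMap fun w => hGc w)
  have h3 : DenseRange (Prod.map (Pi.map F) (Pi.map G) ∘
      Equiv.sumPiEquivProdPi fun i => WithAbs (abv i)) :=
    h1.comp (Equiv.sumPiEquivProdPi fun i => WithAbs (abv i)).surjective.denseRange h2
  have h4 : Continuous (Prod.map (Pi.map F) (Pi.map G) ∘
      Equiv.sumPiEquivProdPi fun i => WithAbs (abv i)) :=
    h2.comp (Homeomorph.sumPiEquivProdPi (S : Type u) (InfinitePlace K) fun i => WithAbs (abv i)).continuous
  -- identify the composite with the diagonal map of the statement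
  have hc1 : ∀ (k : K) (v : S), algebraMap K (v.1.adicCompletion K) k =
      F v (algebraMap K ((i : (S : Type u) ⊕ InfinitePlace K) → WithAbs (abv i)) k (Sum.inl v)) :=
    fun k v => rfl
  have hc2 : ∀ (k : K) (w : InfinitePlace K), algebraMap K (InfiniteAdeleRing K) k w =
      G w (algebraMap K ((i : (S : Type u) ⊕ InfinitePlace K) → WithAbs (abv i)) k (Sum.inr w)) :=
    fun k w => rfl
  have heq : (fun k : K => ((fun v : S => algebraMap K (v.1.adicCompletion K) k),
      algebraMap K (InfiniteAdeleRing K) k)) =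
      (Prod.map (Pi.map F) (Pi.map G) ∘ Equiv.sumPiEquivProdPi fun i => WithAbs (abv i)) ∘
        algebraMap K ((i : (S : Type u) ⊕ InfinitePlace K) → WithAbs (abv i)) := by
    funext k
    exact Prod.ext (funext fun v => hc1 k v) (funext fun w => hc2 k w)
  rw [heq]
  exact h3.comp hd h4

end WeakApproximation

/-! ### Neighbourhoods of `1` in `𝕀_K` with an archimedean condition -/

section Nhds

/-- **Neighbourhoods of `1` in the idele group, archimedean components free near `1`.** Every
neighbourhood `H` of `1` in `𝕀_K` contains all ideles `x` with `x_∞, (x⁻¹)_∞` in a suitable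
neighbourhood `U₁` of `1` in `K ⊗ ℝ`, `x_v ∈ 𝒪_vˣ` for all finite `v`, and
`x_v ≡ 1 (mod 𝔭_v^{e_v})` for `v` in a finite set `T` (variant of
`ideleGroup_exists_congruenceSubgroup_subset`, same proof: units topology, `𝔸_K = 𝔸_K^∞ × 𝔸_{K,f}`,
`∏_w 𝒪_w ↪ 𝔸_{K,f}` an embedding). Ref: Neukirch, *Algebraic Number Theory*, Ch. VI §1 (basic open
sets of `I_K`). [folklore] -/
theorem ideleGroup_exists_nhds_congruenceSubgroup_subset {H : Set (ideleGroup K)} (hH : H ∈ 𝓝 1) :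
    ∃ U₁ ∈ 𝓝 (1 : InfiniteAdeleRing K), ∃ T : Set (HeightOneSpectrum (𝓞 K)), T.Finite ∧
      ∃ e : HeightOneSpectrum (𝓞 K) → ℕ,
      ∀ x : ideleGroup K, (x : AdeleRing (𝓞 K) K).1 ∈ U₁ →
        ((x⁻¹ : ideleGroup K) : AdeleRing (𝓞 K) K).1 ∈ U₁ →
        (∀ v, Valued.v ((x : AdeleRing (𝓞 K) K).2 v) = 1) →
        (∀ v ∈ T, Valued.v ((x : AdeleRing (𝓞 K) K).2 v - 1) ≤ WithZero.exp (-(e v : ℤ))) →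
        x ∈ H := by
  obtain ⟨U, hU, hUH⟩ := Units.exists_nhds_one_val_inv hH
  obtain ⟨U₁, hU₁, U₂, hU₂, hU12⟩ := mem_nhds_prod_iff.mp hU
  set sM := (RestrictedProduct.structureMap (fun v : HeightOneSpectrum (𝓞 K) => v.adicCompletion K)
    (fun v => (v.adicCompletionIntegers K : Set (v.adicCompletion K))) cofinite) with hsM
  have hc : Continuous (sM : _ → FiniteAdeleRing (𝓞 K) K) :=
    RestrictedProduct.isEmbedding_structureMap.continuous
  have h1 : (sM 1 : FiniteAdeleRing (𝓞 K) K) = 1 := FiniteAdeleRing.ext K fun v => rfl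
  have hpre : sM ⁻¹' U₂ ∈ 𝓝 (1 : Π v : HeightOneSpectrum (𝓞 K), v.adicCompletionIntegers K) :=
    hc.continuousAt.preimage_mem_nhds (by rw [h1]; exact hU₂)
  rw [nhds_pi, Filter.mem_pi] at hpre
  obtain ⟨I, hI, t, ht, htU⟩ := hpre
  choose e he using fun v => adicCompletionIntegers_exists_ball_subset v (ht v)
  have key : ∀ x : ideleGroup K, (x : AdeleRing (𝓞 K) K).1 ∈ U₁ →
      (∀ v, Valued.v ((x : AdeleRing (𝓞 K) K).2 v) ≤ 1) →
      (∀ v ∈ I, Valued.v ((x : AdeleRing (𝓞 K) K).2 v - 1) ≤ WithZero.exp (-(e v : ℤ))) →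
      (x : AdeleRing (𝓞 K) K) ∈ U := by
    intro x hx1 hxu hxT
    set y : Π v : HeightOneSpectrum (𝓞 K), v.adicCompletionIntegers K :=
      fun v => ⟨(x : AdeleRing (𝓞 K) K).2 v, hxu v⟩ with hy
    have hy2 : (sM y : FiniteAdeleRing (𝓞 K) K) = (x : AdeleRing (𝓞 K) K).2 :=
      FiniteAdeleRing.ext K fun v => rfl
    have hyU : y ∈ sM ⁻¹' U₂ := htU fun v hv => he v (y v) (hxT v hv)
    have : (x : AdeleRing (𝓞 K) K) =
        ((x : AdeleRing (𝓞 K) K).1, (sM y : FiniteAdeleRing (𝓞 K) K)) := Prod.ext rfl hy2.symm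
    rw [this]
    exact hU12 (Set.mk_mem_prod hx1 hyU)
  refine ⟨U₁, hU₁, I, hI, e, fun x hx1 hx1' hxu hxT => hUH x (key x hx1 (fun v => (hxu v).le) hxT) ?_⟩
  refine key x⁻¹ hx1' (fun v => ?_) (fun v hv => ?_)
  · rw [ideleGroup_val_inv_snd, map_inv₀, hxu, inv_one]
  · rw [ideleGroup_val_inv_snd]
    have hx0 : (x : AdeleRing (𝓞 K) K).2 v ≠ 0 := fun h => by simpa [h] using hxu v
    calc Valued.v (((x : AdeleRing (𝓞 K) K).2 v)⁻¹ - 1)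
        = Valued.v (((x : AdeleRing (𝓞 K) K).2 v)⁻¹ * (1 - (x : AdeleRing (𝓞 K) K).2 v)) := by
          rw [mul_sub, mul_one, inv_mul_cancel₀ hx0]
      _ = Valued.v ((x : AdeleRing (𝓞 K) K).2 v - 1) := by
          rw [map_mul, map_inv₀, hxu, inv_one, one_mul, Valuation.map_sub_swap]
      _ ≤ _ := hxT v hv

end Nhds

/-! ### `K^× 𝕀_K^S` is dense: Hecke characters trivial locally off `S` are trivial -/

namespace HeckeCharacter

/-- **A Hecke character trivial on `K_vˣ` for all `v ∉ S` kills the ideles supported off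
`S ∪ ∞`.** If `χ ∘ localUnits v = 1` for every finite `v ∉ S`, then `χ z = 1` for every idele `z`
with `z_∞ = 1` and `z_v = 1` for `v ∈ S` (`z` is in the closure of the finite products
`∏_{v ∈ T} localUnits v (z_v)`, `T ∩ S`-factors being trivial, and `ker χ` is closed).
Cassels–Fröhlich, Ch. VII §4, proof of Prop. 4.1 (the factor `ψ((ax)_2)`, `(ax)_2 ∈ J_K^S`).
[cite: CasselsFrohlichANT1967, Ch. VII §4 Prop. 4.1 (proof)] -/
theorem eq_one_of_fst_eq_one {χ : HeckeCharacter K} {S : Set (HeightOneSpectrum (𝓞 K))}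
    (h : ∀ v ∉ S, ∀ u : (v.adicCompletion K)ˣ, χ (localUnits v u) = 1)
    (z : ideleGroup K) (hz1 : (z : AdeleRing (𝓞 K) K).1 = 1)
    (hzS : ∀ v ∈ S, (z : AdeleRing (𝓞 K) K).2 v = 1) : χ z = 1 := by
  classical
  have hcl : IsClosed {y : ideleGroup K | χ y = 1} :=
    isClosed_eq (map_continuous χ) continuous_const
  suffices hz : z ∈ closure {y : ideleGroup K | χ y = 1} by
    rw [hcl.closure_eq] at hz
    exact hz
  rw [mem_closure_iff_nhds]
  intro N hN
  have hN1 : {y : ideleGroup K | z * y ∈ N} ∈ 𝓝 (1 : ideleGroup K) := by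
    have : N ∈ 𝓝 (z * 1) := by rwa [mul_one]
    exact (continuous_const_mul z).continuousAt.preimage_mem_nhds this
  obtain ⟨T, hT, e, hTe⟩ := ideleGroup_exists_congruenceSubgroup_subset hN1
  have hT₀ := ideleGroup_valued_snd_eventually_eq_one z
  rw [Filter.eventually_cofinite] at hT₀
  set T' : Finset (HeightOneSpectrum (𝓞 K)) := hT.toFinset ∪ hT₀.toFinset with hT'
  let u : ∀ q : HeightOneSpectrum (𝓞 K), (q.adicCompletion K)ˣ := fun q =>
    Units.mk0 ((z : AdeleRing (𝓞 K) K).2 q) (ideleGroup_snd_ne_zero z q)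
  set zT : ideleGroup K := ∏ q ∈ T', localUnits q (u q) with hzT
  have hχzT : χ zT = 1 := by
    rw [hzT, map_prod]
    refine Finset.prod_eq_one fun q _ => ?_
    by_cases hq : q ∈ S
    · have hu : u q = 1 := Units.ext (by simp [u, hzS q hq])
      rw [hu, map_one, map_one]
    · exact h q hq (u q)
  refine ⟨zT, ?_, hχzT⟩
  have hmem : z * (z⁻¹ * zT) ∈ N := by
    refine hTe (z⁻¹ * zT) ?_ ?_ ?_
    · rw [ideleGroup_val_fst_mul, fst_prod_localUnits, mul_one]
      have := ideleGroup_val_inv_fst_mul z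
      rwa [hz1, mul_one] at this
    · intro v
      rw [ideleGroup_val_snd_mul, ideleGroup_val_inv_snd, snd_prod_localUnits]
      split_ifs with hv
      · rw [Units.val_mk0, inv_mul_cancel₀ (ideleGroup_snd_ne_zero z v), map_one]
      · have hv1 : Valued.v ((z : AdeleRing (𝓞 K) K).2 v) = 1 := by
          by_contra hne
          exact hv (Finset.mem_union_right _ (hT₀.mem_toFinset.2 hne))
        rw [mul_one, map_inv₀, hv1, inv_one]
    · intro v hv
      have hv' : v ∈ T' := Finset.mem_union_left _ (hT.mem_toFinset.2 hv)
      rw [ideleGroup_val_snd_mul, ideleGroup_val_inv_snd, snd_prod_localUnits, if_pos hv',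
        Units.val_mk0, inv_mul_cancel₀ (ideleGroup_snd_ne_zero z v), sub_self, map_zero]
      exact zero_le
  rwa [mul_inv_cancel_left] at hmem

/-- **`K^× 𝕀_K^S` is dense in `𝕀_K` (character form): a Hecke character trivial on `K_vˣ` for all
finite `v` outside a finite set `S` is trivial.** Cassels–Fröhlich, Ch. VII (Tate), §4, Prop. 4.1,
uniqueness, with its printed proof: for `x ∈ J_K` and `a ∈ K^*`,
`ψ(x) = ψ(ax) = ψ((ax)_1) ψ((ax)_2)` where `(ax)_1` keeps the components at `S` (here `S ∪ ∞`) and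
`(ax)_2 ∈ J_K^S`; by the weak approximation theorem (Ch. II §6) there are `a_n ∈ K^*` with
`a_n → x⁻¹` at all places of `S`, so `ψ(x) = lim ψ((a_n x)_1) = 1` by continuity. Here:
`denseRange_algebraMap_pi_prod` supplies `a`, `eq_one_of_fst_eq_one` kills `(x a⁻¹)_2`,
`map_principal` kills `a`, and `(x a⁻¹)_1` lies in a prescribed neighbourhood of `1`
(`ideleGroup_exists_nhds_congruenceSubgroup_subset`), whence `χ x` lies in every neighbourhood of
`1`. [cite: CasselsFrohlichANT1967, Ch. VII §4 Prop. 4.1 (proof)] -/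
theorem eq_one_of_forall_localUnits {χ : HeckeCharacter K} {S : Finset (HeightOneSpectrum (𝓞 K))}
    (h : ∀ v ∉ S, ∀ u : (v.adicCompletion K)ˣ, χ (localUnits v u) = 1) : χ = 1 := by
  classical
  refine HeckeCharacter.ext fun x => ?_
  rw [one_apply]
  suffices hmain : ∀ W ∈ 𝓝 (1 : ℂˣ), χ x ∈ W by
    by_contra hx
    exact hmain {w | w ≠ χ x} (isOpen_ne.mem_nhds (Ne.symm hx)) rfl
  intro W hW
  have hN : χ ⁻¹' W ∈ 𝓝 (1 : ideleGroup K) :=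
    (map_continuous χ).continuousAt.preimage_mem_nhds (by rwa [map_one])
  obtain ⟨U₁, hU₁, T, hT, e, hTe⟩ := ideleGroup_exists_nhds_congruenceSubgroup_subset hN
  -- notation
  set xinf : InfiniteAdeleRing K := (x : AdeleRing (𝓞 K) K).1 with hxinf
  set xiinf : InfiniteAdeleRing K := ((x⁻¹ : ideleGroup K) : AdeleRing (𝓞 K) K).1 with hxiinf
  have hinv : ∀ (y : ideleGroup K) (w : InfinitePlace K),
      ((y⁻¹ : ideleGroup K) : AdeleRing (𝓞 K) K).1 w = ((y : AdeleRing (𝓞 K) K).1 w)⁻¹ := by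
    intro y w
    have h := congrFun (ideleGroup_val_inv_fst_mul y) w
    change ((y⁻¹ : ideleGroup K) : AdeleRing (𝓞 K) K).1 w * (y : AdeleRing (𝓞 K) K).1 w = 1 at h
    exact eq_inv_of_mul_eq_one_left h
  have hx0 : ∀ w : InfinitePlace K, xinf w ≠ 0 := by
    intro w
    have h := congrFun (ideleGroup_val_inv_fst_mul x) w
    change xiinf w * xinf w = 1 at h
    exact right_ne_zero_of_mul_eq_one h
  have hxi : ∀ w : InfinitePlace K, xiinf w = (xinf w)⁻¹ := fun w => hinv x w
  have hxf0 : ∀ v : HeightOneSpectrum (𝓞 K), (x : AdeleRing (𝓞 K) K).2 v ≠ 0 :=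
    ideleGroup_snd_ne_zero x
  -- the space `Y = (∏_{v ∈ S} K_v) × K_∞`, the target point and the four test maps
  let y₀ : (∀ v : S, v.1.adicCompletion K) × InfiniteAdeleRing K :=
    (fun v => (x : AdeleRing (𝓞 K) K).2 v.1, xinf)
  let f₁ : (∀ v : S, v.1.adicCompletion K) × InfiniteAdeleRing K → InfiniteAdeleRing K :=
    fun p => fun w => xinf w * (p.2 w)⁻¹
  let f₂ : (∀ v : S, v.1.adicCompletion K) × InfiniteAdeleRing K → InfiniteAdeleRing K :=
    fun p => fun w => p.2 w * xiinf w
  let g : ∀ v : S, (∀ v : S, v.1.adicCompletion K) × InfiniteAdeleRing K → v.1.adicCompletion K :=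
    fun v p => (x : AdeleRing (𝓞 K) K).2 v.1 * (p.1 v)⁻¹
  have hf₁ : ContinuousAt f₁ y₀ := by
    refine continuousAt_pi.2 fun w => ?_
    have hc : ContinuousAt (fun p : (∀ v : S, v.1.adicCompletion K) × InfiniteAdeleRing K => p.2 w)
        y₀ := ((continuous_apply w).comp continuous_snd).continuousAt
    exact continuousAt_const.mul (hc.inv₀ (hx0 w))
  have hf₂ : ContinuousAt f₂ y₀ := by
    refine continuousAt_pi.2 fun w => ?_
    have hc : ContinuousAt (fun p : (∀ v : S, v.1.adicCompletion K) × InfiniteAdeleRing K => p.2 w)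
        y₀ := ((continuous_apply w).comp continuous_snd).continuousAt
    exact hc.mul continuousAt_const
  have hg : ∀ v, ContinuousAt (g v) y₀ := by
    intro v
    have hc : ContinuousAt (fun p : (∀ v : S, v.1.adicCompletion K) × InfiniteAdeleRing K => p.1 v)
        y₀ := ((continuous_apply v).comp continuous_fst).continuousAt
    exact continuousAt_const.mul (hc.inv₀ (hxf0 v.1))
  have hf₁y : f₁ y₀ = 1 := funext fun w => mul_inv_cancel₀ (hx0 w)
  have hf₂y : f₂ y₀ = 1 := funext fun w => by
    change xinf w * xiinf w = 1
    rw [hxi, mul_inv_cancel₀ (hx0 w)]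
  have hgy : ∀ v, g v y₀ = 1 := fun v => mul_inv_cancel₀ (hxf0 v.1)
  -- congruence balls are neighbourhoods of `1`
  have hB : ∀ (v : HeightOneSpectrum (𝓞 K)) (m : ℕ),
      {c : v.adicCompletion K | Valued.v (c - 1) < WithZero.exp (-(m : ℤ))} ∈
        𝓝 (1 : v.adicCompletion K) := by
    intro v m
    set z : v.adicCompletion K :=
      ((uniformizer K v : (v.adicCompletion K)ˣ) : v.adicCompletion K) ^ m with hzdef
    have hz : Valued.v z = WithZero.exp (-(m : ℤ)) := by
      rw [hzdef, map_pow, valued_uniformizer, ← WithZero.exp_nsmul]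
      congr 1
      simp
    have hopen : IsOpen {c : v.adicCompletion K | Valued.v (c - 1) < Valued.v z} := by
      have h1 : IsOpen {y : v.adicCompletion K | Valued.v y < Valued.v z} := by
        simpa only [Valuation.restrict_lt_iff] using
          Valued.isOpen_ball (v.adicCompletion K) (Valued.v.restrict z)
      exact h1.preimage (continuous_id.sub continuous_const)
    rw [← hz]
    refine hopen.mem_nhds ?_
    change Valued.v ((1 : v.adicCompletion K) - 1) < Valued.v z
    rw [sub_self, map_zero, hz]
    exact zero_lt_iff.2 WithZero.coe_ne_zero
  -- a non-empty set of infinite places, to force `a ≠ 0`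
  obtain ⟨w₀⟩ : Nonempty (InfinitePlace K) := inferInstance
  have hO : {p : (∀ v : S, v.1.adicCompletion K) × InfiniteAdeleRing K | p.2 w₀ ≠ 0} ∈ 𝓝 y₀ :=
    (isOpen_ne_fun ((continuous_apply w₀).comp continuous_snd) continuous_const).mem_nhds (hx0 w₀)
  -- the good neighbourhood of `y₀` and an `a ∈ K` in it
  have h𝒩 : f₁ ⁻¹' U₁ ∩ (f₂ ⁻¹' U₁ ∩ ({p | p.2 w₀ ≠ 0} ∩
      ⋂ v : S, g v ⁻¹' {c | Valued.v (c - 1) < WithZero.exp (-((e v.1 + 1 : ℕ) : ℤ))})) ∈ 𝓝 y₀ := by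
    refine Filter.inter_mem (hf₁.preimage_mem_nhds (by rw [hf₁y]; exact hU₁))
      (Filter.inter_mem (hf₂.preimage_mem_nhds (by rw [hf₂y]; exact hU₁))
        (Filter.inter_mem hO ((Filter.iInter_mem).2 fun v => ?_)))
    exact (hg v).preimage_mem_nhds (by rw [hgy]; exact hB v.1 _)
  obtain ⟨a, ha₁, ha₂, ha₃, ha₄⟩ := (denseRange_algebraMap_pi_prod S).mem_nhds h𝒩
  simp only [Set.mem_iInter, Set.mem_preimage, Set.mem_setOf_eq] at ha₁ ha₂ ha₃ ha₄
  have ha0 : a ≠ 0 := by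
    rintro rfl
    exact ha₃ (by rw [map_zero]; rfl)
  -- the units built from `a` and `x`
  set A : Kˣ := Units.mk0 a ha0 with hA
  set X : ∀ v : HeightOneSpectrum (𝓞 K), (v.adicCompletion K)ˣ := fun v =>
    Units.map (ideleGroup.finComp v) (toUnits x) with hX
  set c : ∀ v : HeightOneSpectrum (𝓞 K), (v.adicCompletion K)ˣ := fun v =>
    X v * (globalToLocalUnits v A)⁻¹ with hc
  set Xinf : (InfiniteAdeleRing K)ˣ := Units.map ideleGroup.infComp (toUnits x) with hXinf
  set u : ideleGroup K :=
    infiniteIdeles K (Xinf * (globalToInfiniteUnits K A)⁻¹) * ∏ v ∈ S, localUnits v (c v) with hu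
  -- components of `u`
  have hcv : ∀ v, (c v : v.adicCompletion K) =
      (x : AdeleRing (𝓞 K) K).2 v * (algebraMap K (v.adicCompletion K) a)⁻¹ := fun v => by
    rw [hc]; dsimp only; rw [Units.val_mul, Units.val_inv_eq_inv_val]; rfl
  have hu1 : (u : AdeleRing (𝓞 K) K).1 = f₁ ((fun v : S => algebraMap K (v.1.adicCompletion K) a),
      algebraMap K (InfiniteAdeleRing K) a) := by
    rw [hu, ideleGroup_val_fst_mul, fst_prod_localUnits, mul_one, infiniteIdeles_fst]
    funext w
    change xinf w * algebraMap K (InfiniteAdeleRing K) (a⁻¹ : K) w =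
      xinf w * (algebraMap K (InfiniteAdeleRing K) a w)⁻¹
    rw [InfiniteAdeleRing.algebraMap_apply, InfiniteAdeleRing.algebraMap_apply,
      ← InfinitePlace.Completion.algebraMap_apply, ← InfinitePlace.Completion.algebraMap_apply,
      map_inv₀]
  have hu2 : ∀ v, (u : AdeleRing (𝓞 K) K).2 v =
      if v ∈ S then (x : AdeleRing (𝓞 K) K).2 v * (algebraMap K (v.adicCompletion K) a)⁻¹
      else 1 := fun v => by
    rw [hu, ideleGroup_val_snd_mul, infiniteIdeles_snd, one_mul, snd_prod_localUnits]
    split_ifs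
    · exact hcv v
    · rfl
  have hu1w : ∀ w, (u : AdeleRing (𝓞 K) K).1 w = xinf w * (algebraMap K (InfiniteAdeleRing K) a w)⁻¹ :=
    fun w => by rw [hu1]
  have haw : ∀ w : InfinitePlace K, algebraMap K (InfiniteAdeleRing K) a w ≠ 0 := fun w => by
    rw [InfiniteAdeleRing.algebraMap_apply, ← InfinitePlace.Completion.algebraMap_apply]
    exact (map_ne_zero _).2 ha0
  have hui1 : ((u⁻¹ : ideleGroup K) : AdeleRing (𝓞 K) K).1 =
      f₂ ((fun v : S => algebraMap K (v.1.adicCompletion K) a),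
        algebraMap K (InfiniteAdeleRing K) a) := by
    funext w
    rw [hinv, hu1w]
    change (xinf w * (algebraMap K (InfiniteAdeleRing K) a w)⁻¹)⁻¹ =
      algebraMap K (InfiniteAdeleRing K) a w * xiinf w
    rw [mul_inv_rev, inv_inv, hxi]
  -- `u` lies in the prescribed neighbourhood of `1`
  have huW : u ∈ χ ⁻¹' W := by
    refine hTe u (by rw [hu1]; exact ha₁) (by rw [hui1]; exact ha₂) (fun v => ?_) (fun v hv => ?_)
    · rw [hu2]
      split_ifs with hv
      · have hlt := ha₄ ⟨v, hv⟩
        change Valued.v ((x : AdeleRing (𝓞 K) K).2 v * (algebraMap K (v.adicCompletion K) a)⁻¹ - 1) <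
          _ at hlt
        have h1 : Valued.v ((x : AdeleRing (𝓞 K) K).2 v * (algebraMap K (v.adicCompletion K) a)⁻¹ - 1) <
            Valued.v (1 : v.adicCompletion K) := by
          rw [map_one, ← WithZero.exp_zero]
          exact hlt.trans_le (WithZero.exp_le_exp.2 (by push_cast; omega))
        rw [Valuation.map_eq_of_sub_lt _ h1, map_one]
      · exact map_one _
    · rw [hu2]
      split_ifs with hvS
      · have hlt := ha₄ ⟨v, hvS⟩
        change Valued.v ((x : AdeleRing (𝓞 K) K).2 v * (algebraMap K (v.adicCompletion K) a)⁻¹ - 1) <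
          _ at hlt
        exact hlt.le.trans (WithZero.exp_le_exp.2 (by push_cast; omega))
      · rw [sub_self, map_zero]
        exact zero_le
  -- `x = (a) · u · g` with `χ g = 1`
  have haA : ((A : Kˣ) : K) = a := rfl
  set gI : ideleGroup K := (principalIdele K A * u)⁻¹ * x with hgI
  have hχg : χ gI = 1 := by
    refine eq_one_of_fst_eq_one (S := (S : Set (HeightOneSpectrum (𝓞 K))))
      (fun v hv => h v (by simpa using hv)) gI ?_ ?_
    · funext w
      change (((principalIdele K A * u)⁻¹ : ideleGroup K) : AdeleRing (𝓞 K) K).1 w *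
          xinf w = 1
      rw [hinv]
      change (algebraMap K (InfiniteAdeleRing K) (A : K) w * (u : AdeleRing (𝓞 K) K).1 w)⁻¹ *
        xinf w = 1
      rw [haA, hu1w, mul_left_comm, mul_inv_cancel₀ (haw w), mul_one, inv_mul_cancel₀ (hx0 w)]
    · intro v hv
      have hvS : v ∈ S := by simpa using hv
      have ha0v : algebraMap K (v.adicCompletion K) a ≠ 0 := (map_ne_zero _).2 ha0
      rw [hgI, ideleGroup_val_snd_mul, ideleGroup_val_inv_snd, ideleGroup_val_snd_mul,
        principalIdele_snd, haA, hu2, if_pos hvS, mul_left_comm, mul_inv_cancel₀ ha0v, mul_one,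
        inv_mul_cancel₀ (hxf0 v)]
  have hx : x = principalIdele K A * u * gI := by rw [hgI, mul_inv_cancel_left]
  rw [hx, map_mul, map_mul, χ.map_principal (principalIdele_mem A), one_mul, hχg, mul_one]
  exact huW

/-! ### Consequences: rigidity of Hecke characters -/

/-- **A Hecke character with `χ(ϖ_v) = 1` for almost all `v` is trivial** (`χ` is unramified at
almost all `v`, `finite_ramifiedPlaces_holds`, so `χ_v = 1` on `K_vˣ = ϖ_v^ℤ 𝒪_vˣ` off a finite
set, `map_localUnits_of_valueAtUniformizer_eq_one` of `HeckeCharacterProofs`, and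
`eq_one_of_forall_localUnits` applies).
Cassels–Fröhlich, Ch. VII §4, Prop. 4.1 (uniqueness of `ψ` given its values off `S`).
[cite: CasselsFrohlichANT1967, Ch. VII §4 Prop. 4.1 (proof)] -/
theorem eq_one_of_eventually_valueAtUniformizer_eq_one {χ : HeckeCharacter K}
    (h : ∀ᶠ v in cofinite, χ.valueAtUniformizer v = 1) : χ = 1 := by
  classical
  have hur : ∀ᶠ v in cofinite, χ.IsUnramifiedAt v :=
    χ.finite_ramifiedPlaces_iff.1 (finite_ramifiedPlaces_holds χ)
  have hS := hur.and h
  rw [Filter.eventually_cofinite] at hS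
  refine eq_one_of_forall_localUnits (S := hS.toFinset) fun v hv u => ?_
  have hv' : χ.IsUnramifiedAt v ∧ χ.valueAtUniformizer v = 1 := by
    by_contra hc
    exact hv (hS.mem_toFinset.2 hc)
  exact map_localUnits_of_valueAtUniformizer_eq_one hv'.1 hv'.2 u

/-- **Rigidity ("multiplicity one for `GL(1)`"): two Hecke characters with the same values at
almost all uniformizers are equal** (apply `eq_one_of_eventually_valueAtUniformizer_eq_one` to
`χ₁ χ₂⁻¹`). Cassels–Fröhlich, Ch. VII §4, Prop. 4.1 (uniqueness) with §3.7–3.8 (a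
Grössencharakter is determined by the admissible map `v ↦ χ(𝔭_v)` on `I^S`).
[cite: CasselsFrohlichANT1967, Ch. VII §4 Prop. 4.1 (proof)] -/
theorem ext_of_eventually_valueAtUniformizer_eq {χ₁ χ₂ : HeckeCharacter K}
    (h : ∀ᶠ v in cofinite, χ₁.valueAtUniformizer v = χ₂.valueAtUniformizer v) : χ₁ = χ₂ := by
  have h1 : χ₁ * χ₂⁻¹ = 1 := by
    refine eq_one_of_eventually_valueAtUniformizer_eq_one (h.mono fun v hv => ?_)
    have hne : χ₂.valueAtUniformizer v ≠ 0 := by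
      simp only [valueAtUniformizer]
      exact Units.ne_zero _
    simp only [valueAtUniformizer, localComponent_apply, mul_apply, inv_apply, Units.val_mul,
      Units.val_inv_eq_inv_val] at hv hne ⊢
    rw [hv, mul_inv_cancel₀ hne]
  exact mul_inv_eq_one.1 h1

end HeckeCharacter

end Literature.NumberTheory.GaloisRepresentations
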